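import Summits.HodgeConjecture.HodgeConjecture.Theorems.F0P3FormProjection
import Summits.HodgeConjecture.HodgeConjecture.Theorems.H413SpectrumPartsPin
import Summits.HodgeConjecture.HodgeConjecture.Theorems.H413CohFormsCarriersLemmas
import Summits.HodgeConjecture.HodgeConjecture.Theorems.P4StubT1ArchFactor
import Literature.NumberTheory.Automorphic.UnitaryGroupCotangentSpectralProjection
import Literature.NumberTheory.Automorphic.UnitaryGroupCotangentSpectralProjectionConj
import HarnessLib

/-!
# Crux `H413`, line `F0_U3CohMultOne` — the form-level spectral projections `Φ ↦ Φ_P` AT THE PIN, from the letters (D) BY NAME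

Floor-0 programme P3 «U3-mult», seat F0P3-p02 (g0, filed by its lineage re-seat g2); crux item stmt-HodgeConjecture-24833
(`HCCMUnconditional.H413`); P3 rung-1 (D)h infrastructure, ENGINE-INTERFACES §7 (3)(i).
HC_CM is proved only modulo the printed citations until rung 0 closes.

For the crux carriers (`adelicDatum F V`, `rightRep F V`, `holCotForms (archFactorOf F V)` and its `conjFun`-image; ★
`Theorems/H413CohFormsCarriers`) and a discrete automorphic `P ≤ L²(U(V)(F⁺)\U(V)(𝔸_{F⁺}), μ)`: from the typer's letters (D) ★
`CotangentForms.holCotFormSpectralProjection` / `antiholCotFormSpectralProjection` (representability of the spectral projection of a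
(anti)holomorphic cotangent form by one of the same type) and the continuity of cohomological cotangent forms (A-p09's lemma, hypothesis
`hcont`), the generic ★ `F0P3FormProjection.exists_formProjection` yields `ℂ`-LINEAR, `U(V)(𝔸_{F⁺,f})`-EQUIVARIANT projections
`prF : X →ₗ[ℂ] X` carrying `holCotForms 𝔞₀` (resp. `conj holCotForms 𝔞₀`) into itself, with `P.ContainsForm (prF Φ)`, coordinate classes
`[(prF Φ)_j] = pr_P [Φ_j]`, and `prF Φ ≠ 0` whenever `P` meets a class of `Φ` — `exists_holFormProjection_pin`,
`exists_antiholFormProjection_pin`; and, by the conjugation symmetry (D̄) ⇐ (D) (★ `CotangentForms.antiholCotFormSpectralProjection_of_hol`,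
F0P2-p01 (g2)), the antiholomorphic one from the HOLOMORPHIC letter alone — `exists_antiholFormProjection_pin_of_hol`.  Inputs: left-invariance
(★ p04 `leftInvariant_of_mem_holCotForms` / `leftInvariant_of_mem_cohForms_pin`), `rightRep`-stability (★ A-p13 `ArchFactor.IsHonest.rightRep_mem_holCotForms`,
★ `ArchFactor.IsHonest.rightRep_mem_map_conjFun_holCotForms` + ★ `archFactorOf_isHonest`), `2 ≤ [F⁺:ℚ]` from `4 ≤ [F:ℚ]` (★
`SpectrumJunction.two_le_finrank_maximalRealSubfield`).  These are the objects the S3/S4 folds (p03: `ψ ↦ prF_{P₀} ∘ ψ` lands IN `P₀`, feeding ★ p04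
`hasFinComponent_of_equivariant` and letter (E)) and programme P2's U2a consume.

References: [BorelJacquet1979] A. Borel, H. Jacquet, Automorphic forms and automorphic representations, Corvallis PSPM 33.1 (1979), §4.6;
[Borel1997] A. Borel, Automorphic forms on `SL₂(ℝ)`, Thm. 2.13, §8.4; [Dixmier1977] J. Dixmier, C*-algebras, §13.1; [BorelWallach2000] VII 2.10.
-/

-- the mandated namespace repeats `HodgeConjecture.HodgeConjecture`, as in every `Theorems/*.lean` of this sub-problem
set_option linter.dupNamespace false

noncomputable section

open MeasureTheory NumberField
open scoped InnerProductSpace ENNReal ComplexOrder Matrix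

namespace Summit.HodgeConjecture.HodgeConjecture.Cruxes.H413.F0P3FormProjection

open Literature.NumberTheory.Automorphic Literature.NumberTheory.Automorphic.UnitaryGroup
open Literature.NumberTheory.Automorphic.UnitaryGroup.CotangentForms (toQuotFun cmArchSection cmCompactFactor
  holCotFormSpectralProjection antiholCotFormSpectralProjection antiholCotFormSpectralProjection_of_hol)
open Summit.HodgeConjecture.HodgeConjecture.Cruxes.H413.CohFormsCarriers
open Summit.HodgeConjecture.HodgeConjecture.Cruxes.H413.SpectrumJunction
open Summit.HodgeConjecture.HodgeConjecture.Cruxes.H413.P4StubT1ArchFactor (archFactorOf_isHonest)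

variable {F : HodgeCM.CMField} {ι₁ : F →+* ℂ} {V : HodgeCM.HermSpace3 F ι₁}

set_option synthInstance.maxHeartbeats 400000 in
set_option maxHeartbeats 4000000 in
/-- **THE HOLOMORPHIC FORM-LEVEL PROJECTION AT THE PIN, from letter (D) by name.**  `[F:ℚ] ≥ 4`, `μ` automorphic, cotangent forms continuous,
`P` discrete: a linear `prF` with — for every `Φ ∈ holCotForms (archFactorOf F V)` — `prF Φ ∈ holCotForms (archFactorOf F V)`,
`P.ContainsForm (prF Φ)`, coordinate classes `pr_P [Φ_j] = [(prF Φ)_j]` (any `MemLp` witnesses), `prF (R_g Φ) = R_g (prF Φ)`, and `prF Φ ≠ 0` if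
`P` is not orthogonal to some `[Φ_j]`. [cite: BorelJacquet1979, §4.6] [cite: Borel1997, Thm. 2.13 and §8.4] -/
theorem exists_holFormProjection_pin (hDh : holCotFormSpectralProjection) (h4 : 4 ≤ Module.finrank ℚ F)
    {μ : Measure (adelicDatum F V).automorphicQuotient} [(adelicDatum F V).IsAutomorphicMeasure μ]
    (hcont : ∀ f ∈ cohForms (archFactorOf F V), ∀ j : Fin 2, Continuous fun x => f x j)
    (P : DiscreteAutomorphicRep (adelicDatum F V) μ) :
    ∃ prF : ((adelicDatum F V).Adelic → (Fin 2 → ℂ)) →ₗ[ℂ] ((adelicDatum F V).Adelic → (Fin 2 → ℂ)),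
      (∀ Φ ∈ holCotForms (archFactorOf F V), prF Φ ∈ holCotForms (archFactorOf F V) ∧ P.ContainsForm (prF Φ) ∧
        ∀ (j : Fin 2) (h : MemLp (toQuotFun (adelicDatum F V) fun x => Φ x j) 2 μ)
          (h' : MemLp (toQuotFun (adelicDatum F V) fun x => prF Φ x j) 2 μ),
          P.space.toSubmodule.starProjection h.toLp = (h'.toLp : (adelicDatum F V).L2 μ)) ∧
      (∀ (g : ↥(HodgeCM.HermSpace3.adelicFin V)), ∀ Φ ∈ holCotForms (archFactorOf F V),
          prF (rightRep F V g Φ) = rightRep F V g (prF Φ)) ∧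
      (∀ Φ ∈ holCotForms (archFactorOf F V), ∀ (j : Fin 2) (h : MemLp (toQuotFun (adelicDatum F V) fun x => Φ x j) 2 μ),
          (∃ u ∈ P.space, ⟪(u : (adelicDatum F V).L2 μ), h.toLp⟫_ℂ ≠ 0) → prF Φ ≠ 0) := by
  haveI := compactSpace_automorphicQuotient_adelicDatum F V h4
  have h2 := two_le_finrank_maximalRealSubfield F h4
  -- the four inputs of the generic construction, at `A = holCotForms 𝔞₀`
  have hinv : ∀ Φ ∈ holCotForms (archFactorOf F V), ∀ γ ∈ (adelicDatum F V).quotientSubgroup, ∀ x, Φ (γ * x) = Φ x :=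
    fun Φ hΦ => leftInvariant_of_mem_holCotForms (ιinf := (archFactorOf F V).ιinf) (Kc := (archFactorOf F V).Kc) hΦ
  have hcontA : ∀ Φ ∈ holCotForms (archFactorOf F V), ∀ j : Fin 2, Continuous fun x => Φ x j :=
    fun Φ hΦ j => hcont Φ (holCotForms_le_cohForms _ hΦ) j
  have hstab : ∀ (g : ↥(HodgeCM.HermSpace3.adelicFin V)), ∀ Φ ∈ holCotForms (archFactorOf F V),
      rightRep F V g Φ ∈ holCotForms (archFactorOf F V) :=
    fun g Φ hΦ => (archFactorOf_isHonest F V).rightRep_mem_holCotForms hΦ g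
  have hrep : ∀ Φ (hΦ : Φ ∈ holCotForms (archFactorOf F V)), ∃ Φ', ∃ hΦ' : Φ' ∈ holCotForms (archFactorOf F V), ∀ j : Fin 2,
      P.space.toSubmodule.starProjection ((memLp_coord (μ := μ) (hinv Φ hΦ) (hcontA Φ hΦ) j).toLp _) =
        (memLp_coord (μ := μ) (hinv Φ' hΦ') (hcontA Φ' hΦ') j).toLp _ := by
    intro Φ hΦ
    obtain ⟨Ψ, hΨ, hΨmem, hproj⟩ := hDh (HodgeCM.CMField.K F) ι₁ (HodgeCM.HermSpace3.Hm V) V.sylvesterFrame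
      (HodgeCM.Model.sylvesterFrame_J V) V.posDef_of_ne h2 μ P Φ hΦ (fun j => memLp_coord (μ := μ) (hinv Φ hΦ) (hcontA Φ hΦ) j)
    exact ⟨Ψ, hΨ, fun j => hproj j⟩
  obtain ⟨prF, hcls, hcont', heqv, hne⟩ := exists_formProjection P (holCotForms (archFactorOf F V)) hinv hcontA hstab hrep
  refine ⟨prF, fun Φ hΦ => ?_, heqv, fun Φ hΦ j h hu => hne Φ hΦ ⟨j, hu⟩⟩
  obtain ⟨hP, hj⟩ := hcls Φ hΦ
  exact ⟨hP, hcont' Φ hΦ, fun j h h' => hj j⟩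

set_option synthInstance.maxHeartbeats 400000 in
set_option maxHeartbeats 4000000 in
/-- **THE ANTIHOLOMORPHIC FORM-LEVEL PROJECTION AT THE PIN, from letter (D) by name** — the same for `(holCotForms (archFactorOf F V)).map (conjFun F V)`.
[cite: BorelJacquet1979, §4.6] [cite: Borel1997, Thm. 2.13 and §8.4] [cite: BorelWallach2000, VII 2.10] -/
theorem exists_antiholFormProjection_pin (hDa : antiholCotFormSpectralProjection) (h4 : 4 ≤ Module.finrank ℚ F)
    {μ : Measure (adelicDatum F V).automorphicQuotient} [(adelicDatum F V).IsAutomorphicMeasure μ]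
    (hcont : ∀ f ∈ cohForms (archFactorOf F V), ∀ j : Fin 2, Continuous fun x => f x j)
    (P : DiscreteAutomorphicRep (adelicDatum F V) μ) :
    ∃ prF : ((adelicDatum F V).Adelic → (Fin 2 → ℂ)) →ₗ[ℂ] ((adelicDatum F V).Adelic → (Fin 2 → ℂ)),
      (∀ Φ ∈ (holCotForms (archFactorOf F V)).map (conjFun F V),
        prF Φ ∈ (holCotForms (archFactorOf F V)).map (conjFun F V) ∧ P.ContainsForm (prF Φ) ∧
        ∀ (j : Fin 2) (h : MemLp (toQuotFun (adelicDatum F V) fun x => Φ x j) 2 μ)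
          (h' : MemLp (toQuotFun (adelicDatum F V) fun x => prF Φ x j) 2 μ),
          P.space.toSubmodule.starProjection h.toLp = (h'.toLp : (adelicDatum F V).L2 μ)) ∧
      (∀ (g : ↥(HodgeCM.HermSpace3.adelicFin V)), ∀ Φ ∈ (holCotForms (archFactorOf F V)).map (conjFun F V),
          prF (rightRep F V g Φ) = rightRep F V g (prF Φ)) ∧
      (∀ Φ ∈ (holCotForms (archFactorOf F V)).map (conjFun F V), ∀ (j : Fin 2)
          (h : MemLp (toQuotFun (adelicDatum F V) fun x => Φ x j) 2 μ),
          (∃ u ∈ P.space, ⟪(u : (adelicDatum F V).L2 μ), h.toLp⟫_ℂ ≠ 0) → prF Φ ≠ 0) := by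
  haveI := compactSpace_automorphicQuotient_adelicDatum F V h4
  have h2 := two_le_finrank_maximalRealSubfield F h4
  have hinv : ∀ Φ ∈ (holCotForms (archFactorOf F V)).map (conjFun F V), ∀ γ ∈ (adelicDatum F V).quotientSubgroup, ∀ x,
      Φ (γ * x) = Φ x :=
    fun Φ hΦ => leftInvariant_of_mem_cohForms_pin (𝔞 := archFactorOf F V) (Submodule.mem_sup_right hΦ)
  have hcontA : ∀ Φ ∈ (holCotForms (archFactorOf F V)).map (conjFun F V), ∀ j : Fin 2, Continuous fun x => Φ x j :=
    fun Φ hΦ j => hcont Φ (Submodule.mem_sup_right hΦ) j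
  have hstab : ∀ (g : ↥(HodgeCM.HermSpace3.adelicFin V)), ∀ Φ ∈ (holCotForms (archFactorOf F V)).map (conjFun F V),
      rightRep F V g Φ ∈ (holCotForms (archFactorOf F V)).map (conjFun F V) :=
    fun g Φ hΦ => (archFactorOf_isHonest F V).rightRep_mem_map_conjFun_holCotForms hΦ g
  have hrep : ∀ Φ (hΦ : Φ ∈ (holCotForms (archFactorOf F V)).map (conjFun F V)),
      ∃ Φ', ∃ hΦ' : Φ' ∈ (holCotForms (archFactorOf F V)).map (conjFun F V), ∀ j : Fin 2,
      P.space.toSubmodule.starProjection ((memLp_coord (μ := μ) (hinv Φ hΦ) (hcontA Φ hΦ) j).toLp _) =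
        (memLp_coord (μ := μ) (hinv Φ' hΦ') (hcontA Φ' hΦ') j).toLp _ := by
    intro Φ hΦ
    obtain ⟨Ψ, hΨ, hΨmem, hproj⟩ := hDa (HodgeCM.CMField.K F) ι₁ (HodgeCM.HermSpace3.Hm V) V.sylvesterFrame
      (HodgeCM.Model.sylvesterFrame_J V) V.posDef_of_ne h2 μ P Φ hΦ (fun j => memLp_coord (μ := μ) (hinv Φ hΦ) (hcontA Φ hΦ) j)
    exact ⟨Ψ, hΨ, fun j => hproj j⟩
  obtain ⟨prF, hcls, hcont', heqv, hne⟩ :=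
    exists_formProjection P ((holCotForms (archFactorOf F V)).map (conjFun F V)) hinv hcontA hstab hrep
  refine ⟨prF, fun Φ hΦ => ?_, heqv, fun Φ hΦ j h hu => hne Φ hΦ ⟨j, hu⟩⟩
  obtain ⟨hP, hj⟩ := hcls Φ hΦ
  exact ⟨hP, hcont' Φ hΦ, fun j h h' => hj j⟩

set_option synthInstance.maxHeartbeats 400000 in
set_option maxHeartbeats 4000000 in
/-- **THE ANTIHOLOMORPHIC FORM-LEVEL PROJECTION AT THE PIN FROM THE HOLOMORPHIC LETTER (D) ALONE** — `exists_antiholFormProjection_pin` with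
its letter (D̄) discharged by the conjugation symmetry ★ `CotangentForms.antiholCotFormSpectralProjection_of_hol` (complex conjugation on
`L²(μ)` carries `P` to the discrete `P̄` and (anti)holomorphic cotangent forms to (holo)antiholomorphic ones).
[cite: BorelJacquet1979, §4.6] [cite: Borel1997, Thm. 2.13 and §8.4] [cite: BorelWallach2000, VII 2.10] -/
theorem exists_antiholFormProjection_pin_of_hol (hDh : holCotFormSpectralProjection) (h4 : 4 ≤ Module.finrank ℚ F)
    {μ : Measure (adelicDatum F V).automorphicQuotient} [(adelicDatum F V).IsAutomorphicMeasure μ]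
    (hcont : ∀ f ∈ cohForms (archFactorOf F V), ∀ j : Fin 2, Continuous fun x => f x j)
    (P : DiscreteAutomorphicRep (adelicDatum F V) μ) :
    ∃ prF : ((adelicDatum F V).Adelic → (Fin 2 → ℂ)) →ₗ[ℂ] ((adelicDatum F V).Adelic → (Fin 2 → ℂ)),
      (∀ Φ ∈ (holCotForms (archFactorOf F V)).map (conjFun F V),
        prF Φ ∈ (holCotForms (archFactorOf F V)).map (conjFun F V) ∧ P.ContainsForm (prF Φ) ∧
        ∀ (j : Fin 2) (h : MemLp (toQuotFun (adelicDatum F V) fun x => Φ x j) 2 μ)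
          (h' : MemLp (toQuotFun (adelicDatum F V) fun x => prF Φ x j) 2 μ),
          P.space.toSubmodule.starProjection h.toLp = (h'.toLp : (adelicDatum F V).L2 μ)) ∧
      (∀ (g : ↥(HodgeCM.HermSpace3.adelicFin V)), ∀ Φ ∈ (holCotForms (archFactorOf F V)).map (conjFun F V),
          prF (rightRep F V g Φ) = rightRep F V g (prF Φ)) ∧
      (∀ Φ ∈ (holCotForms (archFactorOf F V)).map (conjFun F V), ∀ (j : Fin 2)
          (h : MemLp (toQuotFun (adelicDatum F V) fun x => Φ x j) 2 μ),
          (∃ u ∈ P.space, ⟪(u : (adelicDatum F V).L2 μ), h.toLp⟫_ℂ ≠ 0) → prF Φ ≠ 0) :=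
  exists_antiholFormProjection_pin (antiholCotFormSpectralProjection_of_hol hDh) h4 hcont P

end Summit.HodgeConjecture.HodgeConjecture.Cruxes.H413.F0P3FormProjection

end
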